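import Literature.MathematicalPhysics.QuantumFieldTheory.Balaban1983to89.Setup
import HarnessLib

/-!
# Crux stmt-QuantumFields-19936 `HistoryTailL` — S-ALIGN (S1) letters: the real arithmetic of the sharp bound and four site identities

Cell `ym3-torus` (rung R3 = YM₃ on T³ — a RUNG, NOT the Clay problem), width seat `ym-ust-19936-w3` gen 12, `--supports stmt-QuantumFields-19936 --as helper`.
Split off ✓`PoincareLipschitzHierAlignSharpStep` for the 400-line rule: `arith_interior` ∕ `arith_face` (the interior-link and face-link budgets
`D + 7(2Y)² + f`, `N + 14(2Y)² + 7f + w` fit `X∕L + 240((d+1)(X+w))² + (4d+3)w + 7f`), `sub_const_shift`, `sub_const_add`, `corner_of_shift`,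
`corner_false` (def-free).
-/

noncomputable section

namespace Summit.QuantumFields.YangMills.Theorems.PoincareLipschitzHierAlignSharpStepLetters

open Literature.MathematicalPhysics.QuantumFieldTheory.Balaban1983to89

/-! ## §1 Real arithmetic of the final bound -/

/-- The interior-link budget fits the displayed bound. [folklore] -/
theorem arith_interior {X w Y L d f D : ℝ} (hX0 : 0 ≤ X) (hw0 : 0 ≤ w) (hd : 1 ≤ d) (hL : 1 ≤ L) (hf : 0 ≤ f)
    (hY : Y = d * (X + w))
    (hD : D ≤ ((X + 2 * w) + 2 * (X + 2 * w) ^ 2 + 4 * (Y + (X + 2 * w)) ^ 2) / L) :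
    D + 7 * (2 * Y) ^ 2 + f ≤ X / L + 240 * ((d + 1) * (X + w)) ^ 2 + (4 * d + 3) * w + 7 * f := by
  set Y' := (d + 1) * (X + w) with hY'
  have hY'0 : 0 ≤ Y' := by rw [hY']; positivity
  have h1 : X + 2 * w ≤ 2 * Y' := by rw [hY']; nlinarith
  have h2 : Y + (X + 2 * w) ≤ 2 * Y' := by rw [hY, hY']; nlinarith
  have h3 : Y ≤ Y' := by rw [hY, hY']; nlinarith
  have hY0 : 0 ≤ Y := by rw [hY]; nlinarith
  have hq0 : 0 ≤ X + 2 * w := by linarith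
  have hsq1 : (X + 2 * w) ^ 2 ≤ (2 * Y') ^ 2 := pow_le_pow_left₀ hq0 h1 2
  have hsq2 : (Y + (X + 2 * w)) ^ 2 ≤ (2 * Y') ^ 2 := pow_le_pow_left₀ (by positivity) h2 2
  have e2' : (2 * Y') ^ 2 = 4 * Y' ^ 2 := by ring
  have hnum : (X + 2 * w) + 2 * (X + 2 * w) ^ 2 + 4 * (Y + (X + 2 * w)) ^ 2 ≤ X + (2 * w + 24 * Y' ^ 2) := by linarith
  have hL0 : 0 < L := by linarith
  have hdiv : ((X + 2 * w) + 2 * (X + 2 * w) ^ 2 + 4 * (Y + (X + 2 * w)) ^ 2) / L ≤ X / L + (2 * w + 24 * Y' ^ 2) := by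
    rw [div_le_iff₀ hL0, add_mul, div_mul_cancel₀ _ hL0.ne']
    have : 2 * w + 24 * Y' ^ 2 ≤ (2 * w + 24 * Y' ^ 2) * L := le_mul_of_one_le_right (by positivity) hL
    linarith
  have h4 : (2 * Y) ^ 2 ≤ (2 * Y') ^ 2 := pow_le_pow_left₀ (by positivity) (by linarith) 2
  have hdw : 0 ≤ d * w := by positivity
  have hY'2 := sq_nonneg Y'
  have e1 : (4 * d + 3) * w = 4 * (d * w) + 3 * w := by ring
  linarith

/-- The face-link budget fits the displayed bound. [folklore] -/
theorem arith_face {X w Y L d N : ℝ} (f : ℝ) (hX0 : 0 ≤ X) (hw0 : 0 ≤ w) (hd : 1 ≤ d) (hL : 1 ≤ L)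
    (hsmall : 8 * (d + 1) * (X + w) ≤ 1 / 10) (hY : Y = d * (X + w))
    (hN : N ≤ ((X + 2 * w) + 2 * (X + 2 * w) ^ 2 + 4 * (Y + (X + 2 * w)) ^ 2) / L +
      (2 * (2 * d * w) + 4 * ((X + w) + ((2 * d * w) + Y + (2 * d * w) * Y)) ^ 2 + 4 * ((2 * d * w) + Y) ^ 2)) :
    N + 14 * (2 * Y) ^ 2 + (7 * f + w) ≤ X / L + 240 * ((d + 1) * (X + w)) ^ 2 + (4 * d + 3) * w + 7 * f := by
  set Y' := (d + 1) * (X + w) with hY'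
  have hY'0 : 0 ≤ Y' := by rw [hY']; positivity
  have hY'1 : Y' ≤ 1 / 80 := by rw [hY']; nlinarith
  have h1 : X + 2 * w ≤ 2 * Y' := by rw [hY']; nlinarith
  have h2 : Y + (X + 2 * w) ≤ 2 * Y' := by rw [hY, hY']; nlinarith
  have h3 : Y ≤ Y' := by rw [hY, hY']; nlinarith
  have hY0 : 0 ≤ Y := by rw [hY]; nlinarith
  have hq0 : 0 ≤ X + 2 * w := by linarith
  have hω : 2 * d * w ≤ 2 * Y' := by rw [hY']; nlinarith
  have hω0 : 0 ≤ 2 * d * w := by nlinarith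
  have hnum : (X + 2 * w) + 2 * (X + 2 * w) ^ 2 + 4 * (Y + (X + 2 * w)) ^ 2 ≤ X + (2 * w + 24 * Y' ^ 2) := by nlinarith
  have hL0 : 0 < L := by linarith
  have hdiv : ((X + 2 * w) + 2 * (X + 2 * w) ^ 2 + 4 * (Y + (X + 2 * w)) ^ 2) / L ≤ X / L + (2 * w + 24 * Y' ^ 2) := by
    rw [div_le_iff₀ hL0, add_mul, div_mul_cancel₀ _ hL0.ne']
    have : 2 * w + 24 * Y' ^ 2 ≤ (2 * w + 24 * Y' ^ 2) * L := le_mul_of_one_le_right (by positivity) hL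
    linarith
  have h5 : (2 * d * w) * Y ≤ Y' := by
    calc (2 * d * w) * Y ≤ (2 * Y') * Y := mul_le_mul_of_nonneg_right hω hY0
      _ ≤ (2 * Y') * Y' := mul_le_mul_of_nonneg_left h3 (by positivity)
      _ ≤ (2 * Y') * (1 / 2) := mul_le_mul_of_nonneg_left (by linarith) (by positivity)
      _ = Y' := by ring
  have hXw : X + w ≤ Y' := by rw [hY']; nlinarith
  have h6 : (X + w) + ((2 * d * w) + Y + (2 * d * w) * Y) ≤ 5 * Y' := by linarith
  have h6' : 0 ≤ (X + w) + ((2 * d * w) + Y + (2 * d * w) * Y) := by positivity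
  have h7 : ((X + w) + ((2 * d * w) + Y + (2 * d * w) * Y)) ^ 2 ≤ (5 * Y') ^ 2 := pow_le_pow_left₀ h6' h6 2
  have h8' : 0 ≤ (2 * d * w) + Y := by positivity
  have h8 : ((2 * d * w) + Y) ^ 2 ≤ (3 * Y') ^ 2 := pow_le_pow_left₀ h8' (by linarith) 2
  have h9 : (2 * Y) ^ 2 ≤ (2 * Y') ^ 2 := pow_le_pow_left₀ (by positivity) (by linarith) 2
  have e5 : (5 * Y') ^ 2 = 25 * Y' ^ 2 := by ring
  have e3 : (3 * Y') ^ 2 = 9 * Y' ^ 2 := by ring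
  have e2 : (2 * Y') ^ 2 = 4 * Y' ^ 2 := by ring
  have hdw : 0 ≤ d * w := by positivity
  have hY'2 := sq_nonneg Y'
  have e1 : (4 * d + 3) * w = 4 * (d * w) + 3 * w := by ring
  have e4 : 2 * (2 * d * w) = 4 * (d * w) := by ring
  linarith

/-! ## §2 Small geometric letters -/

variable {P : Params} {j : ℕ}

/-- Subtracting a constant commutes with a step: `(x + e_μ) − c𝟙 = (x − c𝟙) + e_μ`. [folklore] -/
theorem sub_const_shift (x : Site P j) (μ : Fin P.d) (c : ZMod (P.sitesPerDir j)) :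
    (fun i => Site.shift x μ i - c) = Site.shift (fun i => x i - c) μ := by
  funext i
  by_cases hi : i = μ
  · subst hi; simp [Site.shift]; ring
  · simp [Site.shift, Function.update_of_ne hi]

/-- `x = (x − c𝟙) + c𝟙`. [folklore] -/
theorem sub_const_add (x : Site P j) (c : ZMod (P.sitesPerDir j)) : (fun i => (x i - c) + c) = x := by
  funext i; ring

/-- The corner `ε'` of the shifted cell is the corner `ε'[μ ↦ 1]` of the cell (`ε'_μ = 0`). [folklore] -/
theorem corner_of_shift {k : ℕ} (z₀ : Site P k) (ε' : Fin P.d → Bool) (μ : Fin P.d) (hε : ε' μ = false) :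
    (fun i => (Site.shift z₀ μ i + (if ε' i then 1 else 0) : ZMod (P.sitesPerDir k))) =
      fun i => (z₀ i + (if Function.update ε' μ true i then 1 else 0) : ZMod (P.sitesPerDir k)) := by
  funext i
  by_cases hi : i = μ
  · subst hi; simp [Site.shift, hε]
  · simp [Site.shift, Function.update_of_ne hi]

/-- The all-zero corner is the cell corner itself. [folklore] -/
theorem corner_false {k : ℕ} (z₀ : Site P k) :
    (fun i => (z₀ i + (if (fun _ : Fin P.d => false) i then 1 else 0) : ZMod (P.sitesPerDir k))) = z₀ := by
  funext i; simp

end Summit.QuantumFields.YangMills.Theorems.PoincareLipschitzHierAlignSharpStepLetters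

end
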